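import Summits.AtomisticToContinuum.BoseEinsteinCondensation.Theorems.BECConjugateDominationHardCoreExtensionAlphaPhysGeometry
import HarnessLib

/-!
# (α'_phys) part 2/4: the cut state `χΨ` — form bound, mass splitting, mass ≤ 1
# — line `third-law-current-floor`, crux `HardCoreExtension` (stmt-AtomisticToContinuum-11786), lead c1

For `v = ⊤` on `[0,a]`, `v ≤ M ≤ m` beyond `a`, a trial state `Ψ` and a `C¹` cut-off `χ ∈ [0,1]` vanishing on the hard set with
`|∇χ|² ≤ C/ℓ²` supported in the open outer shell: `q_v(χΨ) ≤ (1+θ)𝓔_{min(v,m)}[Ψ] + (1+θ⁻¹)(C/ℓ²)·(outer-shell mass)`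
(IMS/Young multiplier bound `kineticDensity_ofReal_mul_le`, Literature), `1 ≤ ‖χΨ‖² + (hard-set mass) + (outer-shell mass)`,
`‖χΨ‖² ≤ 1`. [folklore]
-/

noncomputable section

namespace Summit.AtomisticToContinuum.BoseEinsteinCondensation.Cruxes.HardCoreExtension.ThirdLawCurrentFloor

open MeasureTheory Filter
open scoped ENNReal NNReal BigOperators Topology
open Literature.MathematicalPhysics.QuantumManyBody.BoseGas
open Summit.AtomisticToContinuum.BoseEinsteinCondensation.Theorems.PositiveMinimiser

namespace AlphaPhys

variable {N : ℕ} {L : ℝ}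

/-! ### The cut state `χΨ` (the pointwise multiplier bound is `kineticDensity_ofReal_mul_le` of
`Literature/…/PeriodicMultiplierKineticBound.lean`) -/

/-- A `[0,1]`-valued real multiplier shrinks the modulus. [folklore] -/
theorem nnnorm_ofReal_mul_le {χ : Config N → ℝ} (hχ : ∀ X, 0 ≤ χ X ∧ χ X ≤ 1) (ψ : Config N → ℂ)
    (X : Config N) : ‖(χ X : ℂ) * ψ X‖₊ ≤ ‖ψ X‖₊ := by
  rw [nnnorm_mul, ← NNReal.coe_le_coe, NNReal.coe_mul, coe_nnnorm, coe_nnnorm, Complex.norm_real,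
    Real.norm_eq_abs, abs_of_nonneg (hχ X).1]
  exact mul_le_of_le_one_left (norm_nonneg _) (hχ X).2

/-! ### The cut state and its energy -/

section CutState

variable {v : ℝ → ℝ≥0∞} {a ℓ C θ : ℝ} {M : ℝ≥0∞} {m : ℕ} {χ : Config N → ℝ}

/-- **Energy of the cut state.** For `v = ⊤` on `[0,a]`, `v ≤ M ≤ m` beyond `a`, a trial state `Ψ`, and a cut-off `χ ∈ C¹`,
`0 ≤ χ ≤ 1`, `χ = 0` on the hard set, `|∇χ|² ≤ C/ℓ²` and `∇χ = 0` off the open outer shell: the `v`-form of `u = χΨ`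
is at most `(1+θ)·𝓔_{min(v,m)}[Ψ] + (1+θ⁻¹)(C/ℓ²)·∫_{outer shell ∩ cell}|Ψ|²`. [folklore] -/
theorem cutState_form_le (hv : Measurable v) (hM : ∀ r, a < r → v r ≤ M) (hm : M ≤ (m : ℝ≥0∞))
    (Ψ : PeriodicTrialState N L) (hχ1 : ContDiff ℝ 1 χ) (hχ01 : ∀ X, 0 ≤ χ X ∧ χ X ≤ 1)
    (hχ0 : ∀ X : Config N, (∃ i j : Fin N, i ≠ j ∧ ∃ n : Fin 3 → ℤ, ‖X i - X j - latticeVec L n‖ ≤ a) → χ X = 0)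
    (hχC : ∀ X : Config N, kineticDensity (fun Y => (χ Y : ℂ)) X ≤ ENNReal.ofReal (C / ℓ ^ 2))
    (hχfar : ∀ X : Config N, (∀ i j : Fin N, i ≠ j → ∀ n : Fin 3 → ℤ,
        ‖X i - X j - latticeVec L n‖ ≤ a ∨ a + ℓ ≤ ‖X i - X j - latticeVec L n‖) →
      kineticDensity (fun Y => (χ Y : ℂ)) X = 0)
    (hθ : 0 < θ) :
    ∫⁻ X in cellN N L, kineticDensity (fun Y => (χ Y : ℂ) * Ψ.ψ Y) X +
        periodicInteraction v L X * ((‖(χ X : ℂ) * Ψ.ψ X‖₊ : ℝ≥0∞)) ^ 2 ≤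
      ENNReal.ofReal (1 + θ) * periodicEnergy (fun r => min (v r) (m : ℝ≥0∞)) Ψ +
        ENNReal.ofReal ((1 + θ⁻¹) * (C / ℓ ^ 2)) *
          ∫⁻ X in {X : Config N | ∃ i j : Fin N, i ≠ j ∧ ∃ n : Fin 3 → ℤ,
              a < ‖X i - X j - latticeVec L n‖ ∧ ‖X i - X j - latticeVec L n‖ < a + ℓ} ∩ cellN N L,
            ((‖Ψ.ψ X‖₊ : ℝ≥0∞)) ^ 2 := by
  -- the outer shell
  have hOm : MeasurableSet {X : Config N | ∃ i j : Fin N, i ≠ j ∧ ∃ n : Fin 3 → ℤ,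
      a < ‖X i - X j - latticeVec L n‖ ∧ ‖X i - X j - latticeVec L n‖ < a + ℓ} :=
    measurableSet_pairImage (S := Set.Ioo a (a + ℓ)) L measurableSet_Ioo
  have hθ1 : (1 : ℝ≥0∞) ≤ ENNReal.ofReal (1 + θ) := by
    rw [← ENNReal.ofReal_one]; exact ENNReal.ofReal_le_ofReal (by linarith)
  have hΨd : Differentiable ℝ Ψ.ψ := Ψ.contDiff.differentiable one_ne_zero
  have hχd : Differentiable ℝ χ := hχ1.differentiable one_ne_zero
  -- pointwise bound
  have hpt : ∀ X : Config N,
      kineticDensity (fun Y => (χ Y : ℂ) * Ψ.ψ Y) X +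
          periodicInteraction v L X * ((‖(χ X : ℂ) * Ψ.ψ X‖₊ : ℝ≥0∞)) ^ 2 ≤
        ENNReal.ofReal (1 + θ) * (kineticDensity Ψ.ψ X +
            periodicInteraction (fun r => min (v r) (m : ℝ≥0∞)) L X * ((‖Ψ.ψ X‖₊ : ℝ≥0∞)) ^ 2) +
          ENNReal.ofReal ((1 + θ⁻¹) * (C / ℓ ^ 2)) *
            {X : Config N | ∃ i j : Fin N, i ≠ j ∧ ∃ n : Fin 3 → ℤ,
              a < ‖X i - X j - latticeVec L n‖ ∧ ‖X i - X j - latticeVec L n‖ < a + ℓ}.indicator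
              (fun X => ((‖Ψ.ψ X‖₊ : ℝ≥0∞)) ^ 2) X := by
    intro X
    -- kinetic part
    have hkin := kineticDensity_ofReal_mul_le (hΨd X) (hχd X) hθ
    have hA : ENNReal.ofReal ((1 + θ) * χ X ^ 2) * kineticDensity Ψ.ψ X ≤
        ENNReal.ofReal (1 + θ) * kineticDensity Ψ.ψ X := by
      refine mul_le_mul' (ENNReal.ofReal_le_ofReal ?_) le_rfl
      have hχ2 : χ X ^ 2 ≤ 1 := by
        have := hχ01 X; nlinarith [this.1, this.2]
      nlinarith [hχ2]
    have hB : ENNReal.ofReal (1 + θ⁻¹) * (‖Ψ.ψ X‖₊ : ℝ≥0∞) ^ 2 * kineticDensity (fun Y => (χ Y : ℂ)) X ≤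
        ENNReal.ofReal ((1 + θ⁻¹) * (C / ℓ ^ 2)) *
          {X : Config N | ∃ i j : Fin N, i ≠ j ∧ ∃ n : Fin 3 → ℤ,
            a < ‖X i - X j - latticeVec L n‖ ∧ ‖X i - X j - latticeVec L n‖ < a + ℓ}.indicator
            (fun X => ((‖Ψ.ψ X‖₊ : ℝ≥0∞)) ^ 2) X := by
      by_cases hXO : X ∈ {X : Config N | ∃ i j : Fin N, i ≠ j ∧ ∃ n : Fin 3 → ℤ,
          a < ‖X i - X j - latticeVec L n‖ ∧ ‖X i - X j - latticeVec L n‖ < a + ℓ}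
      · rw [Set.indicator_of_mem hXO, ENNReal.ofReal_mul (by positivity)]
        calc ENNReal.ofReal (1 + θ⁻¹) * (‖Ψ.ψ X‖₊ : ℝ≥0∞) ^ 2 * kineticDensity (fun Y => (χ Y : ℂ)) X
            ≤ ENNReal.ofReal (1 + θ⁻¹) * (‖Ψ.ψ X‖₊ : ℝ≥0∞) ^ 2 * ENNReal.ofReal (C / ℓ ^ 2) :=
              mul_le_mul' le_rfl (hχC X)
          _ = _ := by ring
      · have hzero : kineticDensity (fun Y => (χ Y : ℂ)) X = 0 := by
          refine hχfar X fun i j hij n => ?_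
          by_contra hcon
          push Not at hcon
          exact hXO ⟨i, j, hij, n, hcon.1, hcon.2⟩
        rw [hzero, mul_zero]; exact bot_le
    -- potential part
    have hP : periodicInteraction v L X * ((‖(χ X : ℂ) * Ψ.ψ X‖₊ : ℝ≥0∞)) ^ 2 ≤
        ENNReal.ofReal (1 + θ) *
          (periodicInteraction (fun r => min (v r) (m : ℝ≥0∞)) L X * ((‖Ψ.ψ X‖₊ : ℝ≥0∞)) ^ 2) := by
      by_cases hχX : χ X = 0
      · simp [hχX]
      · have hfar : ∀ i j : Fin N, i ≠ j → ∀ n : Fin 3 → ℤ, a < ‖X i - X j - latticeVec L n‖ := by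
          intro i j hij n
          by_contra hcon
          exact hχX (hχ0 X ⟨i, j, hij, n, not_lt.1 hcon⟩)
        rw [periodicInteraction_eq_trunc_of_far hM hm L hfar]
        calc _ ≤ periodicInteraction (fun r => min (v r) (m : ℝ≥0∞)) L X * ((‖Ψ.ψ X‖₊ : ℝ≥0∞)) ^ 2 :=
              mul_le_mul' le_rfl (pow_le_pow_left' (ENNReal.coe_le_coe.2 (nnnorm_ofReal_mul_le hχ01 Ψ.ψ X)) 2)
          _ = 1 * _ := (one_mul _).symm
          _ ≤ _ := mul_le_mul' hθ1 le_rfl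
    calc _ ≤ (ENNReal.ofReal (1 + θ) * kineticDensity Ψ.ψ X +
          ENNReal.ofReal ((1 + θ⁻¹) * (C / ℓ ^ 2)) *
            {X : Config N | ∃ i j : Fin N, i ≠ j ∧ ∃ n : Fin 3 → ℤ,
              a < ‖X i - X j - latticeVec L n‖ ∧ ‖X i - X j - latticeVec L n‖ < a + ℓ}.indicator
              (fun X => ((‖Ψ.ψ X‖₊ : ℝ≥0∞)) ^ 2) X) +
          ENNReal.ofReal (1 + θ) *
            (periodicInteraction (fun r => min (v r) (m : ℝ≥0∞)) L X * ((‖Ψ.ψ X‖₊ : ℝ≥0∞)) ^ 2) :=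
          add_le_add (hkin.trans (add_le_add hA hB)) hP
      _ = _ := by ring
  -- integrate
  have hmeas1 : Measurable fun X : Config N => ENNReal.ofReal (1 + θ) * (kineticDensity Ψ.ψ X +
      periodicInteraction (fun r => min (v r) (m : ℝ≥0∞)) L X * ((‖Ψ.ψ X‖₊ : ℝ≥0∞)) ^ 2) :=
    measurable_const.mul ((measurable_kineticDensity_of_any Ψ.ψ).add
      ((measurable_periodicInteraction (hv.min measurable_const) L).mul
        ((Ψ.contDiff.continuous.measurable.nnnorm.coe_nnreal_ennreal).pow_const 2)))
  calc _ ≤ ∫⁻ X in cellN N L, ENNReal.ofReal (1 + θ) * (kineticDensity Ψ.ψ X +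
            periodicInteraction (fun r => min (v r) (m : ℝ≥0∞)) L X * ((‖Ψ.ψ X‖₊ : ℝ≥0∞)) ^ 2) +
          ENNReal.ofReal ((1 + θ⁻¹) * (C / ℓ ^ 2)) *
            {X : Config N | ∃ i j : Fin N, i ≠ j ∧ ∃ n : Fin 3 → ℤ,
              a < ‖X i - X j - latticeVec L n‖ ∧ ‖X i - X j - latticeVec L n‖ < a + ℓ}.indicator
              (fun X => ((‖Ψ.ψ X‖₊ : ℝ≥0∞)) ^ 2) X := lintegral_mono fun X => hpt X
    _ = ENNReal.ofReal (1 + θ) * periodicEnergy (fun r => min (v r) (m : ℝ≥0∞)) Ψ +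
          ENNReal.ofReal ((1 + θ⁻¹) * (C / ℓ ^ 2)) *
            ∫⁻ X in cellN N L, {X : Config N | ∃ i j : Fin N, i ≠ j ∧ ∃ n : Fin 3 → ℤ,
              a < ‖X i - X j - latticeVec L n‖ ∧ ‖X i - X j - latticeVec L n‖ < a + ℓ}.indicator
              (fun X => ((‖Ψ.ψ X‖₊ : ℝ≥0∞)) ^ 2) X := by
        rw [lintegral_add_left hmeas1, lintegral_const_mul' _ _ ENNReal.ofReal_ne_top,
          lintegral_const_mul' _ _ ENNReal.ofReal_ne_top]
        rfl
    _ = _ := by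
        rw [lintegral_indicator hOm, Measure.restrict_restrict hOm]

/-- **Mass of the cut state from below**: `1 ≤ ∫_cell |χΨ|² + (core mass) + (outer-shell mass)` (`χ = 1` wherever all
image pairs are at distance `≥ a + ℓ`). [folklore] -/
theorem one_le_mass_cutState_add (Ψ : PeriodicTrialState N L)
    (hχfar1 : ∀ X : Config N, (∀ i j : Fin N, i ≠ j → ∀ n : Fin 3 → ℤ, a + ℓ ≤ ‖X i - X j - latticeVec L n‖) →
      χ X = 1) :
    1 ≤ (∫⁻ X in cellN N L, ((‖(χ X : ℂ) * Ψ.ψ X‖₊ : ℝ≥0∞)) ^ 2) +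
      (∫⁻ X in {X : Config N | ∃ i j : Fin N, i ≠ j ∧ ∃ n : Fin 3 → ℤ,
          ‖X i - X j - latticeVec L n‖ ≤ a} ∩ cellN N L, ((‖Ψ.ψ X‖₊ : ℝ≥0∞)) ^ 2) +
      ∫⁻ X in {X : Config N | ∃ i j : Fin N, i ≠ j ∧ ∃ n : Fin 3 → ℤ,
          a < ‖X i - X j - latticeVec L n‖ ∧ ‖X i - X j - latticeVec L n‖ < a + ℓ} ∩ cellN N L,
        ((‖Ψ.ψ X‖₊ : ℝ≥0∞)) ^ 2 := by
  set K : Set (Config N) := {X : Config N | ∃ i j : Fin N, i ≠ j ∧ ∃ n : Fin 3 → ℤ,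
      ‖X i - X j - latticeVec L n‖ ≤ a} with hK
  set O : Set (Config N) := {X : Config N | ∃ i j : Fin N, i ≠ j ∧ ∃ n : Fin 3 → ℤ,
      a < ‖X i - X j - latticeVec L n‖ ∧ ‖X i - X j - latticeVec L n‖ < a + ℓ} with hO
  have hKm : MeasurableSet K := measurableSet_pairImage (S := Set.Iic a) L measurableSet_Iic
  have hOm : MeasurableSet O := measurableSet_pairImage (S := Set.Ioo a (a + ℓ)) L measurableSet_Ioo
  -- pointwise: `|Ψ|² ≤ |χΨ|² + 1_K|Ψ|² + 1_O|Ψ|²`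
  have hpt : ∀ X : Config N, ((‖Ψ.ψ X‖₊ : ℝ≥0∞)) ^ 2 ≤
      ((‖(χ X : ℂ) * Ψ.ψ X‖₊ : ℝ≥0∞)) ^ 2 + K.indicator (fun X => ((‖Ψ.ψ X‖₊ : ℝ≥0∞)) ^ 2) X +
        O.indicator (fun X => ((‖Ψ.ψ X‖₊ : ℝ≥0∞)) ^ 2) X := by
    intro X
    by_cases hfar : ∀ i j : Fin N, i ≠ j → ∀ n : Fin 3 → ℤ, a + ℓ ≤ ‖X i - X j - latticeVec L n‖
    · rw [hχfar1 X hfar, Complex.ofReal_one, one_mul]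
      exact le_add_right (le_add_right le_rfl)
    · push Not at hfar
      obtain ⟨i, j, hij, n, hn⟩ := hfar
      rcases le_or_gt ‖X i - X j - latticeVec L n‖ a with hle | hgt
      · have hXK : X ∈ K := ⟨i, j, hij, n, hle⟩
        rw [Set.indicator_of_mem hXK]
        exact le_add_right (le_add_left le_rfl)
      · have hXO : X ∈ O := ⟨i, j, hij, n, hgt, hn⟩
        rw [Set.indicator_of_mem hXO]
        exact le_add_left le_rfl
  have hmeasK : Measurable fun X => K.indicator (fun X => ((‖Ψ.ψ X‖₊ : ℝ≥0∞)) ^ 2) X :=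
    ((Ψ.contDiff.continuous.measurable.nnnorm.coe_nnreal_ennreal).pow_const 2).indicator hKm
  have hmeasO : Measurable fun X => O.indicator (fun X => ((‖Ψ.ψ X‖₊ : ℝ≥0∞)) ^ 2) X :=
    ((Ψ.contDiff.continuous.measurable.nnnorm.coe_nnreal_ennreal).pow_const 2).indicator hOm
  calc (1 : ℝ≥0∞) = ∫⁻ X in cellN N L, ((‖Ψ.ψ X‖₊ : ℝ≥0∞)) ^ 2 := Ψ.norm_eq.symm
    _ ≤ ∫⁻ X in cellN N L, ((‖(χ X : ℂ) * Ψ.ψ X‖₊ : ℝ≥0∞)) ^ 2 +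
          K.indicator (fun X => ((‖Ψ.ψ X‖₊ : ℝ≥0∞)) ^ 2) X +
          O.indicator (fun X => ((‖Ψ.ψ X‖₊ : ℝ≥0∞)) ^ 2) X := lintegral_mono fun X => hpt X
    _ = (∫⁻ X in cellN N L, ((‖(χ X : ℂ) * Ψ.ψ X‖₊ : ℝ≥0∞)) ^ 2) +
          (∫⁻ X in cellN N L, K.indicator (fun X => ((‖Ψ.ψ X‖₊ : ℝ≥0∞)) ^ 2) X) +
          ∫⁻ X in cellN N L, O.indicator (fun X => ((‖Ψ.ψ X‖₊ : ℝ≥0∞)) ^ 2) X := by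
        rw [lintegral_add_right _ hmeasO, lintegral_add_right _ hmeasK]
    _ = _ := by
        rw [lintegral_indicator hKm, Measure.restrict_restrict hKm, lintegral_indicator hOm,
          Measure.restrict_restrict hOm]

/-- **Mass of the cut state from above**: `∫_cell |χΨ|² ≤ 1`. [folklore] -/
theorem mass_cutState_le_one (Ψ : PeriodicTrialState N L) (hχ01 : ∀ X, 0 ≤ χ X ∧ χ X ≤ 1) :
    ∫⁻ X in cellN N L, ((‖(χ X : ℂ) * Ψ.ψ X‖₊ : ℝ≥0∞)) ^ 2 ≤ 1 := by
  calc ∫⁻ X in cellN N L, ((‖(χ X : ℂ) * Ψ.ψ X‖₊ : ℝ≥0∞)) ^ 2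
      ≤ ∫⁻ X in cellN N L, ((‖Ψ.ψ X‖₊ : ℝ≥0∞)) ^ 2 :=
        lintegral_mono fun X => pow_le_pow_left' (ENNReal.coe_le_coe.2 (nnnorm_ofReal_mul_le hχ01 Ψ.ψ X)) 2
    _ = 1 := Ψ.norm_eq

end CutState

end AlphaPhys

/-- **Registered landing stub of this support file** (`stub_alphaPhysCutStateForm`, = `AlphaPhys.cutState_form_le` with all
binders explicit): the `v`-form of the cut state `χΨ`. [folklore] -/
theorem stub_alphaPhysCutStateForm :
    ∀ (N : ℕ) (L : ℝ) (v : ℝ → ℝ≥0∞) (a ℓ C θ : ℝ) (M : ℝ≥0∞) (m : ℕ) (χ : Config N → ℝ),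
      Measurable v → (∀ r, a < r → v r ≤ M) → M ≤ (m : ℝ≥0∞) → ∀ Ψ : PeriodicTrialState N L,
      ContDiff ℝ 1 χ → (∀ X, 0 ≤ χ X ∧ χ X ≤ 1) →
      (∀ X : Config N, (∃ i j : Fin N, i ≠ j ∧ ∃ n : Fin 3 → ℤ, ‖X i - X j - latticeVec L n‖ ≤ a) → χ X = 0) →
      (∀ X : Config N, kineticDensity (fun Y => (χ Y : ℂ)) X ≤ ENNReal.ofReal (C / ℓ ^ 2)) →
      (∀ X : Config N, (∀ i j : Fin N, i ≠ j → ∀ n : Fin 3 → ℤ,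
          ‖X i - X j - latticeVec L n‖ ≤ a ∨ a + ℓ ≤ ‖X i - X j - latticeVec L n‖) →
        kineticDensity (fun Y => (χ Y : ℂ)) X = 0) →
      0 < θ →
      ∫⁻ X in cellN N L, kineticDensity (fun Y => (χ Y : ℂ) * Ψ.ψ Y) X +
          periodicInteraction v L X * ((‖(χ X : ℂ) * Ψ.ψ X‖₊ : ℝ≥0∞)) ^ 2 ≤
        ENNReal.ofReal (1 + θ) * periodicEnergy (fun r => min (v r) (m : ℝ≥0∞)) Ψ +
          ENNReal.ofReal ((1 + θ⁻¹) * (C / ℓ ^ 2)) *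
            ∫⁻ X in {X : Config N | ∃ i j : Fin N, i ≠ j ∧ ∃ n : Fin 3 → ℤ,
                a < ‖X i - X j - latticeVec L n‖ ∧ ‖X i - X j - latticeVec L n‖ < a + ℓ} ∩ cellN N L,
              ((‖Ψ.ψ X‖₊ : ℝ≥0∞)) ^ 2 :=
  fun _ _ _ _ _ _ _ _ _ _ hv hM hm Ψ hχ1 hχ01 hχ0 hχC hχfar hθ =>
    AlphaPhys.cutState_form_le hv hM hm Ψ hχ1 hχ01 hχ0 hχC hχfar hθ

end Summit.AtomisticToContinuum.BoseEinsteinCondensation.Cruxes.HardCoreExtension.ThirdLawCurrentFloor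

end
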